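import Literature.MathematicalPhysics.QuantumFieldTheory.Balaban1983to89.B4CubeGreenBox
import Literature.MathematicalPhysics.QuantumFieldTheory.Balaban1983to89.B4Eq220CommutatorField

/-!
# `Balaban1983to89.B4Thm112BoxIdentity` — [Balaban1983RegularityDecay] THEOREM p. 573, the `δG` clause (1.11):
# ON A NESTED PAIR OF BOXES `Ω ⊂ Ω₀`, THE CUTOFF–COMMUTATOR DECOMPOSITION OF
# `δG_k(Ω,Ω₀,A) = G_k(Ω,A) − G_k(Ω₀,A)` AT AN ARBITRARY CONFIGURATION `A` (the covariant form of the identity of the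
# tree's zero-field leaf `B4Delta112ZeroBox`), and the Neumann boundary identity `H(Ω₀)E = EH(Ω)` it rests on

statement-level skeleton of published theorems with citation tags; proofs where landed; nothing here is a claim about the Yang–Mills mass gap

CITATION HEADER.  T. Bałaban, *Regularity and decay of lattice Green's functions*, Commun. Math. Phys. **89** (1983)
571–597, doi:10.1007/bf01214744 [Balaban1983RegularityDecay] (cell paper B4; held text
`paper:balaban1983-cmp89-regularity-decay`, journal page = PDF page + 570; p. 572 (1.3)–(1.6), p. 573 (1.11), p. 579).
Unit `lit-balaban-p17` gen 5 (Phase-2 proof seat p17; HOME `run/shared/lean/pub/lit-balaban/`), SKELETON row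
**B4.Thm@573** (the clause (1.11)–(1.12) on rectangular `Ω ⊂ Ω₀`), **B4.Eq1.6**.  Imports `B4CubeGreenBox` (→
`B4SubBoxCarrier`: the sub-box `Ω = subEmb(Π[0,nMs))` of `Ω₀ = Π[0,nMb)`, `inSub`, `subField`, and the data identities
`boxWt_subEmb`, `blkWt_subEmb`, `contourTrans_subEmb`; → `B4CubeOpReindex`: `cutWt`, `covOp_cut_submatrix`,
`covOp_cut_apply_off`; → `B4Lemma22Invertible`: `greenA_mul_opA`, `opA_mul_greenA`) and `B4Eq220CommutatorField`
(`kOp`, `kOp_eq_opA`: `K_h = hH − Hh`).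

WHAT IS PRINTED.  p. 573: «If Ω ⊂ Ω₀, then for δG_k(Ω, Ω₀, A) defined by the equality δG_k(Ω, Ω₀, A) = G_k(Ω, A) −
G_k(Ω₀, A), (1.11) we have the inequalities …»; p. 572: «G_k(Ω, A) = (−Δ^{η,N}_{A,Ω} + m² + aP_k(A))^{−1} (1.6)», with
the Neumann sum «over the set of all bonds … with end-points … in Ω» (1.3) and the averaging (1.4)–(1.5) over the big
blocks of `Ω` with the contours `Γ^{(k)}_{y,x}`.

WHY THIS FILE / ROUTE.  The print proves (1.11)–(1.12) by cancelling, between the random-walk expansions (2.13) of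
`G_k(Ω,A)` and `G_k(Ω₀,A)`, the walks through interior cubes of `Ω` (p. 579).  The tree's walk-route form of that
argument (`B4Ineq112WalkRoute.ineq112_value`, r01) models `G_k(Ω,A)` on the carrier of `Ω₀` through the Neumann cut and
asks per-cube inputs for the doubly cut cubes, whose pieces `□_j ∖ Ω` are not parallelepipeds for a general nested pair;
the tree's zero-field leaf `B4Delta112ZeroBox` (pv17) instead derives the `δG` bounds from the members of (1.10) on `Ω`
and on `Ω₀` through an exact identity.  This file proves THAT identity at an arbitrary configuration `A` on the
lineage's carriers (`B4Lemma22ReduceZero.opA/greenA` with [B4]'s staircase contours), so that the sequel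
`B4Thm112BoxValue` can feed it with this lineage's uniform members of (1.10) (`B4Thm110BoxUniform`,
`B4Thm110BoxDerivUniform`) — a shorter road than the print's for the lineage, recorded as such.

WHAT THIS MODULE PROVES (all in full; `n = (ℓ+1)^k`, `Ω₀ = Box d ℓ k Mb`, `Ω = Box d ℓ k Ms` placed at the unit
corner `o`, `o + Ms ≤ Mb`, embedded by `subEmb`).
* §1 `subPre` (the preimage of a site of the image), `extV` (extension by zero `E` of a field on `Ω` to `Ω₀`) with
  `extV_subEmb`, `extV_of_not_inSub`, `extV_sub`, `sum_mul_extV` (a sum against `Ev` is a sum over `Ω`); `Layer`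
  (the sites of `Ω` with a bond of `Ω₀` leaving `Ω`).
* §2 `subTrue_eq_opA` (the data of `H(Ω₀,A)` restricted along `subEmb` ARE `H(Ω, A|Ω)`: bonds, blocks, links,
  staircase transporters), `covLap_wt_add` (the covariant Laplacian is additive in the bond weights),
  `covOp_apply_eq_zero_of_sep` (an entry of (1.6) vanishes between distinct, non-adjacent sites of different blocks),
  and **`opA_mulVec_extV`** — THE NEUMANN BOUNDARY IDENTITY `H(Ω₀,A)(Ev) = E(H(Ω,A|Ω)v)` for every field `v` on `Ω`
  vanishing on `Layer` (the bonds of `Ω₀` crossing `∂Ω` see zeros; no averaging block crosses `∂Ω`; the `Ω`-block of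
  the cut operator is `H(Ω,A|Ω)` by `covOp_cut_submatrix`).
* §3 **`deltaG_decomp`** — for every `f` on `Ω`, every real `χ` on `Ω` vanishing on `Layer`, every site `x` of `Ω`
  and colour `i`, with `u = G_k(Ω,A|Ω)f`, `K_χ = χH(Ω,A|Ω) − H(Ω,A|Ω)χ` (`B4Eq220CommutatorField.kOp`):
  `(G_k(Ω,A|Ω)f)(x)_i − (G_k(Ω₀,A)Ef)(x)_i = (1 − χ(x))u(x)_i − (G_k(Ω₀,A)E(K_χu))(x)_i − (G_k(Ω₀,A)E((1−χ)f))(x)_i`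
  (because `H(Ω₀)E(χu) = E(H(Ω)(χu)) = E(χf − K_χu)`).
* §4 `kOp_apply_eq_zero_of_const_near` — `(K_χΦ)(z) = 0` at every site `z` around which `χ` is constant (on the
  lattice neighbours of `z` in the box and on the block of `z`): the source `K_χu` lives where `χ` varies.
HONEST SCOPE.  Pure algebra of the operators (1.3)–(1.6) on the lineage's box carriers, valid for every `A`, `κ`,
`a > 0`, `m² ≥ 0`; no estimate is made here.  The route is NOT the print's cancellation of interior-cube walk terms
(see WHY THIS FILE).  Definitions with bodies (`subPre`, `extV`, `Layer`) and theorems; no `Prop` fact, no `sorry`;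
axioms standard.
-/

namespace Literature.MathematicalPhysics.QuantumFieldTheory.Balaban1983to89.B4Thm112BoxIdentity

open Literature.MathematicalPhysics.QuantumFieldTheory.Balaban1983to89.B4Reflection242 (boxDom mem_boxDom nbrs mem_nbrs
  nbrs_comm blk)
open Literature.MathematicalPhysics.QuantumFieldTheory.Balaban1983to89.B4GaugeCovariance
open Literature.MathematicalPhysics.QuantumFieldTheory.Balaban1983to89.B4Commutators25to211 (mulH opK)
open Literature.MathematicalPhysics.QuantumFieldTheory.Balaban1983to89.B4Lower18Regular (e1 baseEmb stairContour
  blkWt_ne_zero)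
open Literature.MathematicalPhysics.QuantumFieldTheory.Balaban1983to89.B4Lemma22ReduceZero (Box opA greenA)
open Literature.MathematicalPhysics.QuantumFieldTheory.Balaban1983to89.B4Lemma22Invertible (opA_stair_isUnit_det
  greenA_mul_opA opA_mul_greenA)
open Literature.MathematicalPhysics.QuantumFieldTheory.Balaban1983to89.B4Lower18Regular (stairContour_nn stairContour_end)
open Literature.MathematicalPhysics.QuantumFieldTheory.Balaban1983to89.B4Eq220CommutatorField (kOp kOp_eq_opA)
open Literature.MathematicalPhysics.QuantumFieldTheory.Balaban1983to89.B4Ineq110WalkRoute (mulH_mulVec_apply)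
open Literature.MathematicalPhysics.QuantumFieldTheory.Balaban1983to89.B4CubeOpReindex (cutWt covOp_apply covKer
  covOp_cut_submatrix covOp_cut_apply_off)
open Literature.MathematicalPhysics.QuantumFieldTheory.Balaban1983to89.B4SubBoxCarrier (subEmb subEmbY inSub inSub_iff
  subEmb_injective subEmbY_injective blkWt_subEmb_ne_zero inSub_iff_of_blkWt boxWt_subEmb blkWt_subEmb contourTrans_subEmb
  inSub_of_blk_eq)
open Literature.MathematicalPhysics.QuantumFieldTheory.Balaban1983to89.B4CubeGreenBox (subField)
open scoped Matrix

noncomputable section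

variable {d : ℕ}

/-! ## §1. Extension by zero from `Ω` to `Ω₀`; the boundary layer -/

section Ext

variable (ℓ k : ℕ) (Mb Ms o : Fin (d + 1) → ℕ) {ι : Type}

/-- THE PREIMAGE of a site of `Ω₀` lying over `Ω`: `x ↦ x − n·o`. [cite: Balaban1983RegularityDecay, §1 p.572 «Ω ⊂ Ω₀», dictionary] -/
def subPre (x : ↥(Box d ℓ k Mb)) (hx : inSub ℓ k Mb Ms o x) : ↥(Box d ℓ k Ms) :=
  ⟨fun i => x.1 i - (((ℓ + 1) ^ k : ℕ) : ℤ) * (o i : ℤ), by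
    rw [Box, mem_boxDom]
    intro i
    obtain ⟨h1, h2⟩ := hx i
    rw [mul_add] at h2
    refine ⟨by linarith, ?_⟩
    push_cast at h1 h2 ⊢
    linarith⟩

/-- `subEmb (subPre x) = x`. [cite: Balaban1983RegularityDecay, §1 p.572 «Ω ⊂ Ω₀», dictionary] -/
theorem subEmb_subPre (ho : ∀ i, o i + Ms i ≤ Mb i) (x : ↥(Box d ℓ k Mb)) (hx : inSub ℓ k Mb Ms o x) :
    subEmb ℓ k Mb Ms o ho (subPre ℓ k Mb Ms o x hx) = x := by
  apply Subtype.ext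
  funext i
  simp [subEmb, subPre]

/-- `subPre (subEmb a) = a`. [cite: Balaban1983RegularityDecay, §1 p.572 «Ω ⊂ Ω₀», dictionary] -/
theorem subPre_subEmb (ho : ∀ i, o i + Ms i ≤ Mb i) (a : ↥(Box d ℓ k Ms))
    (h : inSub ℓ k Mb Ms o (subEmb ℓ k Mb Ms o ho a)) : subPre ℓ k Mb Ms o (subEmb ℓ k Mb Ms o ho a) h = a := by
  apply subEmb_injective ℓ k Mb Ms o ho
  rw [subEmb_subPre]

/-- **EXTENSION BY ZERO** `E : (Ω × colours → ℝ) → (Ω₀ × colours → ℝ)` — how «an arbitrary function f : Ω → R^N» is fed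
to `G_k(Ω₀, A)` in (1.11). [cite: Balaban1983RegularityDecay, (1.11) p.573, dictionary] -/
def extV (v : ↥(Box d ℓ k Ms) × ι → ℝ) : ↥(Box d ℓ k Mb) × ι → ℝ :=
  fun p => if h : inSub ℓ k Mb Ms o p.1 then v (subPre ℓ k Mb Ms o p.1 h, p.2) else 0

/-- `E v` over `Ω` is `v`. [cite: Balaban1983RegularityDecay, (1.11) p.573, dictionary] -/
theorem extV_subEmb (ho : ∀ i, o i + Ms i ≤ Mb i) (v : ↥(Box d ℓ k Ms) × ι → ℝ) (a : ↥(Box d ℓ k Ms)) (i : ι) :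
    extV ℓ k Mb Ms o v (subEmb ℓ k Mb Ms o ho a, i) = v (a, i) := by
  have h : inSub ℓ k Mb Ms o (subEmb ℓ k Mb Ms o ho a) := (inSub_iff ℓ k Mb Ms o ho _).mpr ⟨a, rfl⟩
  simp only [extV, dif_pos h, subPre_subEmb]

/-- `E v` vanishes off `Ω`. [cite: Balaban1983RegularityDecay, (1.11) p.573, dictionary] -/
theorem extV_of_not_inSub (v : ↥(Box d ℓ k Ms) × ι → ℝ) {p : ↥(Box d ℓ k Mb) × ι} (hp : ¬ inSub ℓ k Mb Ms o p.1) :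
    extV ℓ k Mb Ms o v p = 0 := by
  simp only [extV, dif_neg hp]

/-- `E` is additive. [cite: Balaban1983RegularityDecay, (1.11) p.573, dictionary] -/
theorem extV_sub (v w : ↥(Box d ℓ k Ms) × ι → ℝ) :
    extV ℓ k Mb Ms o (v - w) = extV ℓ k Mb Ms o v - extV ℓ k Mb Ms o w := by
  funext p
  simp only [extV, Pi.sub_apply]
  split_ifs <;> simp

/-- a sum against `E v` over the sites and colours of `Ω₀` is the corresponding sum over `Ω`.
[cite: Balaban1983RegularityDecay, (1.11) p.573, dictionary] -/
theorem sum_mul_extV [Fintype ι] (ho : ∀ i, o i + Ms i ≤ Mb i) (g : ↥(Box d ℓ k Mb) × ι → ℝ)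
    (v : ↥(Box d ℓ k Ms) × ι → ℝ) :
    ∑ p, g p * extV ℓ k Mb Ms o v p = ∑ q : ↥(Box d ℓ k Ms) × ι, g (subEmb ℓ k Mb Ms o ho q.1, q.2) * v q := by
  classical
  set E : (↥(Box d ℓ k Ms) × ι) ↪ (↥(Box d ℓ k Mb) × ι) :=
    ⟨fun q => (subEmb ℓ k Mb Ms o ho q.1, q.2), fun q q' h => by
      obtain ⟨h1, h2⟩ := Prod.mk.inj h
      exact Prod.ext (subEmb_injective ℓ k Mb Ms o ho h1) h2⟩ with hE
  have h1 : ∑ q : ↥(Box d ℓ k Ms) × ι, g (subEmb ℓ k Mb Ms o ho q.1, q.2) * v q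
      = ∑ p ∈ Finset.univ.map E, g p * extV ℓ k Mb Ms o v p := by
    rw [Finset.sum_map]
    refine Finset.sum_congr rfl fun q _ => ?_
    show _ = g (subEmb ℓ k Mb Ms o ho q.1, q.2) * extV ℓ k Mb Ms o v (subEmb ℓ k Mb Ms o ho q.1, q.2)
    rw [extV_subEmb]
  rw [h1]
  symm
  refine Finset.sum_subset (Finset.subset_univ _) fun p _ hp => ?_
  have hp' : ¬ inSub ℓ k Mb Ms o p.1 := by
    intro h
    obtain ⟨a, ha⟩ := (inSub_iff ℓ k Mb Ms o ho _).mp h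
    exact hp (Finset.mem_map.mpr ⟨(a, p.2), Finset.mem_univ _, by rw [hE]; exact Prod.ext ha rfl⟩)
  rw [extV_of_not_inSub ℓ k Mb Ms o v hp', mul_zero]

/-- **THE BOUNDARY LAYER OF `Ω` IN `Ω₀`**: the sites of `Ω` from which a bond of `Ω₀` leaves `Ω` (the bonds removed by
the Neumann condition of `−Δ^{η,N}_{A,Ω}` but present in `−Δ^{η,N}_{A,Ω₀}`). [cite: Balaban1983RegularityDecay, (1.3) p.572, (1.11) p.573] -/
def Layer (ho : ∀ i, o i + Ms i ≤ Mb i) (z : ↥(Box d ℓ k Ms)) : Prop :=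
  ∃ w : ↥(Box d ℓ k Mb), w.1 ∈ nbrs (subEmb ℓ k Mb Ms o ho z).1 ∧ ¬ inSub ℓ k Mb Ms o w

end Ext

/-! ## §2. The Neumann boundary identity `H(Ω₀,A)E = EH(Ω,A|Ω)` on fields vanishing on the layer -/

section Neumann

variable (ℓ k : ℕ) (Mb Ms o : Fin (d + 1) → ℕ) {ι : Type} [Fintype ι] [DecidableEq ι] (F : OrthFlow ι) (κ : ℝ)

/-- **THE DATA OF `H(Ω₀,A)` RESTRICTED ALONG `Ω ⊂ Ω₀` ARE THE DATA OF `H(Ω, A|Ω)`**: bond weights, block weights, link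
variables and the transporters along [B4]'s staircase contours (the blocks and contours of `Ω` are those of `Ω₀` lying
in `Ω`), for every coefficient: the pulled-back operator is `B4Lemma22ReduceZero.opA` of the sub-box at `A|Ω = subField A`.
[cite: Balaban1983RegularityDecay, (1.3)–(1.6) p.572] -/
theorem subTrue_eq_opA (ho : ∀ i, o i + Ms i ≤ Mb i) (hn : 1 ≤ (ℓ + 1) ^ k) (a m2 : ℝ)
    (A : ↥(Box d ℓ k Mb) → ↥(Box d ℓ k Mb) → ℝ) :
    covOp (fun b b' => boxWt ((ℓ + 1) ^ k) (fun i => (ℓ + 1) ^ k * Mb i) (subEmb ℓ k Mb Ms o ho b)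
        (subEmb ℓ k Mb Ms o ho b')) m2
      (B1.aSeq a ((ℓ : ℝ) + 1) k * (((((ℓ + 1) ^ k : ℕ)) : ℝ) ^ (d + 1))⁻¹)
      (fun y' b => blkWt ((ℓ + 1) ^ k) Mb (fun i => (ℓ + 1) ^ k * Mb i) (subEmbY Mb Ms o ho y')
        (subEmb ℓ k Mb Ms o ho b))
      (fun b b' => fieldLink F κ A (subEmb ℓ k Mb Ms o ho b) (subEmb ℓ k Mb Ms o ho b'))
      (fun y' b => contourTrans (fieldLink F κ A) (baseEmb hn Mb) (stairContour hn Mb) (subEmbY Mb Ms o ho y')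
        (subEmb ℓ k Mb Ms o ho b))
      = opA d F κ ℓ k a m2 Ms (baseEmb hn Ms) (stairContour hn Ms) (subField ℓ k Mb Ms o ho A) := by
  have h1 : (fun b b' => boxWt ((ℓ + 1) ^ k) (fun i => (ℓ + 1) ^ k * Mb i) (subEmb ℓ k Mb Ms o ho b)
      (subEmb ℓ k Mb Ms o ho b')) = boxWt ((ℓ + 1) ^ k) (fun i => (ℓ + 1) ^ k * Ms i) :=
    funext fun b => funext fun b' => boxWt_subEmb ℓ k Mb Ms o ho b b'
  have h2 : (fun y' b => blkWt ((ℓ + 1) ^ k) Mb (fun i => (ℓ + 1) ^ k * Mb i) (subEmbY Mb Ms o ho y')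
      (subEmb ℓ k Mb Ms o ho b)) = blkWt ((ℓ + 1) ^ k) Ms (fun i => (ℓ + 1) ^ k * Ms i) :=
    funext fun y' => funext fun b => blkWt_subEmb ℓ k Mb Ms o ho y' b
  have h3 : (fun b b' => fieldLink F κ A (subEmb ℓ k Mb Ms o ho b) (subEmb ℓ k Mb Ms o ho b'))
      = fieldLink F κ (subField ℓ k Mb Ms o ho A) := rfl
  have h4 : (fun y' b => contourTrans (fieldLink F κ A) (baseEmb hn Mb) (stairContour hn Mb) (subEmbY Mb Ms o ho y')
      (subEmb ℓ k Mb Ms o ho b))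
      = contourTrans (fieldLink F κ (subField ℓ k Mb Ms o ho A)) (baseEmb hn Ms) (stairContour hn Ms) :=
    funext fun y' => funext fun b => contourTrans_subEmb ℓ k Mb Ms o F κ ho hn A y' b
  rw [h1, h2, h3, h4]
  rfl

omit [DecidableEq ι] in
/-- the covariant Laplacian (1.3) is additive in the bond weights. [cite: Balaban1983RegularityDecay, (1.3) p.572] -/
theorem covLap_wt_add {X : Type} [Fintype X] [DecidableEq X] [DecidableEq ι] (c₁ c₂ : X → X → ℝ)
    (W : X → X → Matrix ι ι ℝ) :
    covLap (fun z z' => c₁ z z' + c₂ z z') W = covLap c₁ W + covLap c₂ W := by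
  unfold covLap
  rw [← Finset.sum_add_distrib]
  refine Finset.sum_congr rfl fun x _ => ?_
  rw [← Finset.sum_add_distrib]
  refine Finset.sum_congr rfl fun y _ => ?_
  rw [add_smul]

/-- **AN ENTRY OF (1.6) BETWEEN SEPARATED SITES VANISHES**: for `z ≠ z′` joined by no bond (`c(z,z′) = c(z′,z) = 0`) and
lying in no common block, `H((z,i),(z′,i′)) = 0`. [cite: Balaban1983RegularityDecay, (1.3)–(1.6) p.572] -/
theorem covOp_apply_eq_zero_of_sep {X Y : Type} [Fintype X] [Fintype Y] [DecidableEq X] (c : X → X → ℝ) (m2 a : ℝ)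
    (q : Y → X → ℝ) (W : X → X → Matrix ι ι ℝ) (T : Y → X → Matrix ι ι ℝ) {z z' : X} (hne : z ≠ z')
    (h1 : c z z' = 0) (h2 : c z' z = 0) (h3 : ∀ y, q y z * q y z' = 0) (i i' : ι) :
    covOp c m2 a q W T (z, i) (z', i') = 0 := by
  rw [covOp_apply]
  change covKer c m2 a q W T z z' i i' = 0
  have hK : covKer c m2 a q W T z z' = 0 := by
    unfold covKer covLapKer
    rw [if_neg hne, if_neg hne, if_neg hne, h1, h2]
    simp [h3]
  rw [hK, Matrix.zero_apply]

/-- a non-zero Neumann bond weight joins lattice neighbours. [cite: Balaban1983RegularityDecay, (1.3) p.572] -/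
theorem nbrs_of_boxWt_ne_zero {N : Fin (d + 1) → ℕ} {n : ℕ} {z z' : ↥(boxDom N)} (h : boxWt n N z z' ≠ 0) :
    z'.1 ∈ nbrs z.1 := by
  by_contra hc
  exact h (by simp [boxWt, hc])

/-- **THE NEUMANN BOUNDARY IDENTITY** `H(Ω₀,A)(Ev) = E(H(Ω,A|Ω)v)` for every field `v` on `Ω` vanishing on the boundary
layer: the bonds of `Ω₀` crossing `∂Ω` meet only zeros of `Ev`, no averaging block of `Ω₀` crosses `∂Ω`, and on `Ω`
the operator of `Ω₀` with the crossing bonds removed IS the operator (1.6) of `Ω` (same blocks, same staircase contours).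
[cite: Balaban1983RegularityDecay, (1.3)–(1.6) p.572, (1.11) p.573] -/
theorem opA_mulVec_extV (ho : ∀ i, o i + Ms i ≤ Mb i) (hn : 1 ≤ (ℓ + 1) ^ k) (a m2 : ℝ)
    (A : ↥(Box d ℓ k Mb) → ↥(Box d ℓ k Mb) → ℝ) (v : ↥(Box d ℓ k Ms) × ι → ℝ)
    (hv : ∀ z, Layer ℓ k Mb Ms o ho z → ∀ i, v (z, i) = 0) :
    opA d F κ ℓ k a m2 Mb (baseEmb hn Mb) (stairContour hn Mb) A *ᵥ extV ℓ k Mb Ms o v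
      = extV ℓ k Mb Ms o (opA d F κ ℓ k a m2 Ms (baseEmb hn Ms) (stairContour hn Ms) (subField ℓ k Mb Ms o ho A)
          *ᵥ v) := by
  classical
  set n : ℕ := (ℓ + 1) ^ k with hn_def
  set c : ↥(Box d ℓ k Mb) → ↥(Box d ℓ k Mb) → ℝ := boxWt n (fun i => n * Mb i) with hc
  set q : ↥(boxDom Mb) → ↥(Box d ℓ k Mb) → ℝ := blkWt n Mb (fun i => n * Mb i) with hq
  set a' : ℝ := B1.aSeq a ((ℓ : ℝ) + 1) k * ((((n : ℕ)) : ℝ) ^ (d + 1))⁻¹ with ha'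
  set W : ↥(Box d ℓ k Mb) → ↥(Box d ℓ k Mb) → Matrix ι ι ℝ := fieldLink F κ A with hW
  set T : ↥(boxDom Mb) → ↥(Box d ℓ k Mb) → Matrix ι ι ℝ :=
    contourTrans (fieldLink F κ A) (baseEmb hn Mb) (stairContour hn Mb) with hT
  set S : ↥(Box d ℓ k Mb) → Prop := inSub ℓ k Mb Ms o with hS
  -- the crossing weights
  set r : ↥(Box d ℓ k Mb) → ↥(Box d ℓ k Mb) → ℝ := fun z z' => if (S z ↔ S z') then 0 else c z z' with hr
  have hr0 : ∀ z z', (S z ↔ S z') → r z z' = 0 := fun z z' h => by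
    show (if (S z ↔ S z') then 0 else c z z') = 0
    rw [if_pos h]
  have hr1 : ∀ z z', r z z' ≠ 0 → ¬ (S z ↔ S z') ∧ c z z' ≠ 0 := fun z z' h => by
    by_cases hS' : (S z ↔ S z')
    · exact absurd (hr0 z z' hS') h
    · refine ⟨hS', fun hc0 => h ?_⟩
      show (if (S z ↔ S z') then 0 else c z z') = 0
      rw [if_neg hS', hc0]
  have hcr : (fun z z' => cutWt S c z z' + r z z') = c := by
    funext z z'
    show (if (S z ↔ S z') then c z z' else 0) + (if (S z ↔ S z') then 0 else c z z') = c z z'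
    split_ifs <;> simp
  have hop : opA d F κ ℓ k a m2 Mb (baseEmb hn Mb) (stairContour hn Mb) A
      = covOp (cutWt S c) m2 a' q W T + covLap r W := by
    show covLap c W + m2 • (1 : Matrix _ _ ℝ) + a' • projOp q T
      = covLap (cutWt S c) W + m2 • (1 : Matrix _ _ ℝ) + a' • projOp q T + covLap r W
    have : covLap c W = covLap (cutWt S c) W + covLap r W := by
      rw [← covLap_wt_add, hcr]
    rw [this]
    abel
  -- `Ev` vanishes off `Ω` and on the layer
  have hΦoff : ∀ z, ¬ S z → fld (extV ℓ k Mb Ms o v) z = 0 := fun z hz => by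
    funext i; exact extV_of_not_inSub ℓ k Mb Ms o v (p := (z, i)) hz
  have hΦlay : ∀ b, Layer ℓ k Mb Ms o ho b → fld (extV ℓ k Mb Ms o v) (subEmb ℓ k Mb Ms o ho b) = 0 :=
    fun b hb => by
    funext i
    show extV ℓ k Mb Ms o v (subEmb ℓ k Mb Ms o ho b, i) = 0
    rw [extV_subEmb]; exact hv b hb i
  -- a crossing weight at a site of `Ω` puts that site in the layer
  have hlayer : ∀ z z', r z z' ≠ 0 ∨ r z' z ≠ 0 → S z' → fld (extV ℓ k Mb Ms o v) z' = 0 := by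
    intro z z' hrr hz'
    obtain ⟨b, hb⟩ := (inSub_iff ℓ k Mb Ms o ho _).mp hz'
    rw [← hb]
    refine hΦlay b ⟨z, ?_, ?_⟩
    · rw [hb]
      rcases hrr with h | h
      · exact nbrs_comm.mp (nbrs_of_boxWt_ne_zero (hr1 z z' h).2)
      · exact nbrs_of_boxWt_ne_zero (hr1 z' z h).2
    · intro hz
      rcases hrr with h | h
      · exact (hr1 z z' h).1 (iff_of_true hz hz')
      · exact (hr1 z' z h).1 (iff_of_true hz' hz)
  -- (i) the crossing part sees only zeros
  have hcross : covLap r W *ᵥ extV ℓ k Mb Ms o v = 0 := by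
    have hfld : ∀ z, fld (covLap r W *ᵥ extV ℓ k Mb Ms o v) z = 0 := by
      intro z
      rw [covLap_eq_blockOp, fld_blockOp_mulVec]
      refine Finset.sum_eq_zero fun z' _ => ?_
      by_cases hz' : S z'
      · by_cases hrr : r z z' ≠ 0 ∨ r z' z ≠ 0
        · rw [hlayer z z' hrr hz', Matrix.mulVec_zero]
        · push Not at hrr
          obtain ⟨hra, hrb⟩ := hrr
          by_cases hzz : z = z'
          · subst hzz
            -- the diagonal entry: every crossing weight at `z` would put `z` in the layer
            by_cases hex : ∃ x, r x z ≠ 0 ∨ r z x ≠ 0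
            · obtain ⟨x, hx⟩ := hex
              have : fld (extV ℓ k Mb Ms o v) z = 0 := hlayer x z hx hz'
              rw [this, Matrix.mulVec_zero]
            · push Not at hex
              have hK : covLapKer r W z z = 0 := by
                unfold covLapKer
                rw [if_pos rfl, if_pos rfl, hra]
                rw [Finset.sum_eq_zero (fun x _ => by rw [(hex x).1, zero_smul]),
                  Finset.sum_eq_zero (fun x _ => by rw [(hex x).2, zero_smul])]
                simp
              rw [hK, Matrix.zero_mulVec]
          · have hK : covLapKer r W z z' = 0 := by
              unfold covLapKer
              rw [if_neg hzz, if_neg hzz, hra, hrb]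
              simp
            rw [hK, Matrix.zero_mulVec]
      · rw [hΦoff z' hz', Matrix.mulVec_zero]
    funext p
    have := congrFun (hfld p.1) p.2
    simpa [fld] using this
  -- (ii) the cut operator acts on `Ev` as `E(H(Ω)v)`
  have hsub := covOp_cut_submatrix S (subEmb_injective ℓ k Mb Ms o ho) (inSub_iff ℓ k Mb Ms o ho)
    (subEmbY_injective Mb Ms o ho) c m2 a' q W T (fun y b h => blkWt_subEmb_ne_zero ℓ k Mb Ms o ho h)
  rw [subTrue_eq_opA ℓ k Mb Ms o F κ ho hn a m2 A] at hsub
  have hcut : covOp (cutWt S c) m2 a' q W T *ᵥ extV ℓ k Mb Ms o v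
      = extV ℓ k Mb Ms o (opA d F κ ℓ k a m2 Ms (baseEmb hn Ms) (stairContour hn Ms) (subField ℓ k Mb Ms o ho A)
          *ᵥ v) := by
    funext p
    obtain ⟨y, i⟩ := p
    by_cases hy : S y
    · obtain ⟨b, hb⟩ := (inSub_iff ℓ k Mb Ms o ho _).mp hy
      subst hb
      rw [extV_subEmb]
      simp only [Matrix.mulVec, dotProduct]
      rw [sum_mul_extV ℓ k Mb Ms o ho]
      refine Finset.sum_congr rfl ?_
      rintro ⟨b', i'⟩ -
      congr 1
      have := congrFun (congrFun hsub (b, i)) (b', i')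
      simp only [Matrix.submatrix_apply, Prod.map_apply, id_eq] at this
      exact this
    · rw [extV_of_not_inSub ℓ k Mb Ms o _ (p := (y, i)) hy]
      simp only [Matrix.mulVec, dotProduct]
      refine Finset.sum_eq_zero ?_
      rintro ⟨z', i'⟩ -
      by_cases hp' : S z'
      · rw [(covOp_cut_apply_off S c m2 a' q W T (fun y z z' h h' => inSub_iff_of_blkWt ℓ k Mb Ms o h h') hy hp'
          i i').1, zero_mul]
      · rw [extV_of_not_inSub ℓ k Mb Ms o v (p := (z', i')) hp', mul_zero]
  rw [hop, Matrix.add_mulVec, hcross, add_zero, hcut]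

end Neumann

/-! ## §3. The `δG` decomposition -/

section Decomp

variable (ℓ k : ℕ) (Mb Ms o : Fin (d + 1) → ℕ) {ι : Type} [Fintype ι] [DecidableEq ι] (F : OrthFlow ι) (κ : ℝ)

/-- **THE CUTOFF–COMMUTATOR DECOMPOSITION OF `δG_k(Ω,Ω₀,A)f = G_k(Ω,A)f − G_k(Ω₀,A)f`** (read on `Ω`, `f` extended by
zero): for every real `χ` on `Ω` vanishing on the boundary layer, with `u = G_k(Ω,A|Ω)f` and `K_χ = χH − Hχ`
(`H = H(Ω,A|Ω)`),
`(G_k(Ω)f)(x)_i − (G_k(Ω₀)Ef)(x)_i = (1 − χ(x))u(x)_i − (G_k(Ω₀)E(K_χu))(x)_i − (G_k(Ω₀)E((1−χ)f))(x)_i`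
— since `H(Ω₀)E(χu) = E(H(χu)) = E(χf − K_χu)` (`opA_mulVec_extV`).  Every `A`, `κ`; `ℓ, k ≥ 1`, `a > 0`, `m² ≥ 0`
(invertibility of (1.6) on both boxes, `B4Lemma22Invertible`). [cite: Balaban1983RegularityDecay, (1.11) p.573, (1.6) p.572, p.579] -/
theorem deltaG_decomp (ho : ∀ i, o i + Ms i ≤ Mb i) (hℓ : 1 ≤ ℓ) (hk : 1 ≤ k) (hn : 1 ≤ (ℓ + 1) ^ k) {a m2 : ℝ}
    (ha : 0 < a) (hm : 0 ≤ m2) (A : ↥(Box d ℓ k Mb) → ↥(Box d ℓ k Mb) → ℝ) (χv : ↥(Box d ℓ k Ms) → ℝ)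
    (hχ : ∀ z, Layer ℓ k Mb Ms o ho z → χv z = 0) (f : ↥(Box d ℓ k Ms) × ι → ℝ) (x : ↥(Box d ℓ k Ms)) (i : ι) :
    (greenA d F κ ℓ k a m2 Ms (baseEmb hn Ms) (stairContour hn Ms) (subField ℓ k Mb Ms o ho A) *ᵥ f) (x, i)
      - (greenA d F κ ℓ k a m2 Mb (baseEmb hn Mb) (stairContour hn Mb) A *ᵥ extV ℓ k Mb Ms o f)
          (subEmb ℓ k Mb Ms o ho x, i)
      = (1 - χv x) * (greenA d F κ ℓ k a m2 Ms (baseEmb hn Ms) (stairContour hn Ms) (subField ℓ k Mb Ms o ho A)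
          *ᵥ f) (x, i)
        - (greenA d F κ ℓ k a m2 Mb (baseEmb hn Mb) (stairContour hn Mb) A *ᵥ extV ℓ k Mb Ms o
            (kOp F κ ((ℓ + 1) ^ k) (B1.aSeq a ((ℓ : ℝ) + 1) k) m2 Ms (baseEmb hn Ms) (stairContour hn Ms)
                (subField ℓ k Mb Ms o ho A) χv
              *ᵥ (greenA d F κ ℓ k a m2 Ms (baseEmb hn Ms) (stairContour hn Ms) (subField ℓ k Mb Ms o ho A) *ᵥ f)))
          (subEmb ℓ k Mb Ms o ho x, i)
        - (greenA d F κ ℓ k a m2 Mb (baseEmb hn Mb) (stairContour hn Mb) A *ᵥ extV ℓ k Mb Ms o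
            (mulH (ι := ι) (fun z => 1 - χv z) *ᵥ f)) (subEmb ℓ k Mb Ms o ho x, i) := by
  set H := opA d F κ ℓ k a m2 Ms (baseEmb hn Ms) (stairContour hn Ms) (subField ℓ k Mb Ms o ho A) with hH
  set G := greenA d F κ ℓ k a m2 Ms (baseEmb hn Ms) (stairContour hn Ms) (subField ℓ k Mb Ms o ho A) with hG
  set H0 := opA d F κ ℓ k a m2 Mb (baseEmb hn Mb) (stairContour hn Mb) A with hH0
  set G0 := greenA d F κ ℓ k a m2 Mb (baseEmb hn Mb) (stairContour hn Mb) A with hG0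
  set u := G *ᵥ f with hu
  set K := kOp F κ ((ℓ + 1) ^ k) (B1.aSeq a ((ℓ : ℝ) + 1) k) m2 Ms (baseEmb hn Ms) (stairContour hn Ms)
    (subField ℓ k Mb Ms o ho A) χv with hK
  have hHG : H * G = 1 := opA_mul_greenA F κ hℓ hk ha hm Ms (fun y x _ => stairContour_nn hn Ms y x)
    (fun y x h => stairContour_end hn Ms y x h) _
  have hG0H0 : G0 * H0 = 1 := greenA_mul_opA F κ hℓ hk ha hm Mb (fun y x _ => stairContour_nn hn Mb y x)
    (fun y x h => stairContour_end hn Mb y x h) _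
  have hHu : H *ᵥ u = f := by rw [hu, Matrix.mulVec_mulVec, hHG, Matrix.one_mulVec]
  clear_value u
  -- `H(χu) = χf − K_χu`
  have hKdef : K = mulH (ι := ι) χv * H - H * mulH (ι := ι) χv := kOp_eq_opA F κ ℓ k a m2 Ms _ _ _ χv
  have hHχu : H *ᵥ (mulH (ι := ι) χv *ᵥ u) = mulH (ι := ι) χv *ᵥ f - K *ᵥ u := by
    rw [hKdef, Matrix.sub_mulVec, ← Matrix.mulVec_mulVec, ← Matrix.mulVec_mulVec, hHu, Matrix.mulVec_mulVec]
    abel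
  -- `χu` vanishes on the layer
  have hvan : ∀ z, Layer ℓ k Mb Ms o ho z → ∀ j, (mulH (ι := ι) χv *ᵥ u) (z, j) = 0 := fun z hz j => by
    rw [mulH_mulVec_apply, hχ z hz, zero_mul]
  have hid : H0 *ᵥ extV ℓ k Mb Ms o (mulH (ι := ι) χv *ᵥ u) = extV ℓ k Mb Ms o (H *ᵥ (mulH (ι := ι) χv *ᵥ u)) :=
    opA_mulVec_extV ℓ k Mb Ms o F κ ho hn a m2 A (mulH (ι := ι) χv *ᵥ u) hvan
  -- hence `E(χu) = G₀E(χf) − G₀E(K_χu)`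
  have hE : extV ℓ k Mb Ms o (mulH (ι := ι) χv *ᵥ u)
      = G0 *ᵥ extV ℓ k Mb Ms o (mulH (ι := ι) χv *ᵥ f) - G0 *ᵥ extV ℓ k Mb Ms o (K *ᵥ u) := by
    calc extV ℓ k Mb Ms o (mulH (ι := ι) χv *ᵥ u) = G0 *ᵥ (H0 *ᵥ extV ℓ k Mb Ms o (mulH (ι := ι) χv *ᵥ u)) := by
          rw [Matrix.mulVec_mulVec, hG0H0, Matrix.one_mulVec]
      _ = G0 *ᵥ extV ℓ k Mb Ms o (H *ᵥ (mulH (ι := ι) χv *ᵥ u)) := by rw [hid]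
      _ = _ := by rw [hHχu, extV_sub, Matrix.mulVec_sub]
  have h1 := congrFun hE (subEmb ℓ k Mb Ms o ho x, i)
  rw [extV_subEmb, mulH_mulVec_apply] at h1
  simp only [Pi.sub_apply] at h1
  -- split `Ef = E(χf) + E((1−χ)f)`
  have hsplit : extV ℓ k Mb Ms o f
      = extV ℓ k Mb Ms o (mulH (ι := ι) χv *ᵥ f) + extV ℓ k Mb Ms o (mulH (ι := ι) (fun z => 1 - χv z) *ᵥ f) := by
    funext p
    simp only [extV, Pi.add_apply]
    split_ifs with h
    · rw [mulH_mulVec_apply, mulH_mulVec_apply]; ring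
    · simp
  have h2 : (G0 *ᵥ extV ℓ k Mb Ms o f) (subEmb ℓ k Mb Ms o ho x, i)
      = (G0 *ᵥ extV ℓ k Mb Ms o (mulH (ι := ι) χv *ᵥ f)) (subEmb ℓ k Mb Ms o ho x, i)
        + (G0 *ᵥ extV ℓ k Mb Ms o (mulH (ι := ι) (fun z => 1 - χv z) *ᵥ f)) (subEmb ℓ k Mb Ms o ho x, i) := by
    rw [hsplit, Matrix.mulVec_add]; rfl
  rw [h2]
  linarith

end Decomp

/-! ## §4. The commutator source lives where `χ` varies -/

section Local

variable {ι : Type} [Fintype ι] [DecidableEq ι] (F : OrthFlow ι) (κ : ℝ)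

/-- **`(K_χΦ)(z) = 0` WHEREVER `χ` IS LOCALLY CONSTANT**: if `χ` takes the value `χ(z)` at every lattice neighbour of `z`
in the box and on the block of `z`, the commutator `K_χ = χH − Hχ` of (2.10) annihilates every field at `z` (an entry
`H((z,i),(z′,i′))` of (1.6) is non-zero only for `z′ = z`, `z′ ∼ z` or `z′` in the block of `z`).
[cite: Balaban1983RegularityDecay, (2.10) p.576, (1.3)–(1.6) p.572] -/
theorem kOp_apply_eq_zero_of_const_near {n : ℕ} (a m2 : ℝ) (M : Fin (d + 1) → ℕ)
    (emb : ↥(boxDom M) → ↥(boxDom fun i => n * M i))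
    (Γ : ↥(boxDom M) → ↥(boxDom fun i => n * M i) → List ↥(boxDom fun i => n * M i))
    (A : ↥(boxDom fun i => n * M i) → ↥(boxDom fun i => n * M i) → ℝ) (h : ↥(boxDom fun i => n * M i) → ℝ)
    (Φ : ↥(boxDom fun i => n * M i) × ι → ℝ) (z : ↥(boxDom fun i => n * M i))
    (h1 : ∀ z' : ↥(boxDom fun i => n * M i), z'.1 ∈ nbrs z.1 → h z' = h z)
    (h2 : ∀ z' : ↥(boxDom fun i => n * M i), blk n z'.1 = blk n z.1 → h z' = h z) (i : ι) :
    (kOp F κ n a m2 M emb Γ A h *ᵥ Φ) (z, i) = 0 := by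
  classical
  rw [kOp, opK, Matrix.sub_mulVec, Pi.sub_apply, ← Matrix.mulVec_mulVec, ← Matrix.mulVec_mulVec, mulH_mulVec_apply,
    Matrix.mulVec, Matrix.mulVec, dotProduct, dotProduct, Finset.mul_sum, ← Finset.sum_sub_distrib]
  refine Finset.sum_eq_zero fun p' _ => ?_
  rw [mulH_mulVec_apply, ← mul_assoc, ← mul_assoc, ← sub_mul]
  by_cases hh : h p'.1 = h z
  · rw [hh, mul_comm (h z), sub_self, zero_mul]
  · -- `p'.1` is neither `z`, nor a neighbour of `z`, nor in the block of `z`: the entry vanishes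
    have hne : z ≠ p'.1 := fun h0 => hh (by rw [← h0])
    have hnb : p'.1.1 ∉ nbrs z.1 := fun h0 => hh (h1 p'.1 h0)
    have hnb' : z.1 ∉ nbrs p'.1.1 := fun h0 => hnb (nbrs_comm.mp h0)
    have hc1 : boxWt n (fun i => n * M i) z p'.1 = 0 := by simp [boxWt, hnb]
    have hc2 : boxWt n (fun i => n * M i) p'.1 z = 0 := by simp [boxWt, hnb']
    have hq : ∀ y : ↥(boxDom M), blkWt n M (fun i => n * M i) y z * blkWt n M (fun i => n * M i) y p'.1 = 0 := by
      intro y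
      by_contra h0
      obtain ⟨hy1, hy2⟩ := mul_ne_zero_iff.mp h0
      exact hh (h2 p'.1 ((blkWt_ne_zero hy2).trans (blkWt_ne_zero hy1).symm))
    rw [show covOp (boxWt n fun i => n * M i) m2 (a * ((n : ℝ) ^ (d + 1))⁻¹) (blkWt n M fun i => n * M i)
        (fieldLink F κ A) (contourTrans (fieldLink F κ A) emb Γ) (z, i) p' = 0 from by
      obtain ⟨z', i'⟩ := p'
      exact covOp_apply_eq_zero_of_sep _ _ _ _ _ _ hne hc1 hc2 hq i i']
    simp

end Local

end

end Literature.MathematicalPhysics.QuantumFieldTheory.Balaban1983to89.B4Thm112BoxIdentity
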